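import Mathlib.Algebra.BigOperators.Ring.Finset
import Mathlib.Data.Fintype.Pi
import Literature.Topology.FourManifolds.KhComplex
import HarnessLib

/-!
# Two-dimensional faces of the cube of resolutions commute (abstract form)

This file isolates the algebra behind `d² = 0` for the Khovanov complex of a Gauss diagram
(`GaussDiagram.khovanovD_comp_khovanovD` in `Literature.Topology.FourManifolds.KhComplex`;
Khovanov (2000), Prop. 8: the cube `V_D` is commutative because the (1+1)-dimensional TQFT of the
Frobenius algebra `A` is a functor on planar cobordisms). In the enhanced-state model the TQFT is
replaced by explicit incidence numbers between labellings of state circles, and the functoriality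
by the present finite statement about an abstract finite set `X` of "arcs":

* four "circle maps" `c₀₀, c₁₀, c₀₁, c₁₁ : X → Yₖ` (the state circles of the four states of a
  face, as functions on arcs), four points `α β α' β' : X` (the local strands at the two chords),
  and for each edge of the face its *kind* (`Kind.merge` / `Kind.split`) together with the surgery
  relation `Surg` saying that the finer circle map becomes the coarser one by uniting the classes
  of the two strands (for Gauss diagrams this is `GaussDiagram.IsMergeAt.reachable_update_iff` /
  `GaussDiagram.IsSplitAt.reachable_iff` of `Literature.Topology.FourManifolds.KhFlipReach`);
* the unsigned incidence numbers `mergeInc`, `splitInc` of `KhComplex.incidence` written for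
  abstract circle maps (same tables `mergeCoeff`, `splitCoeff` of `A = R[X]/(X² - hX - t)`), and
  labellings `Lab c` constant on classes;
* the **face theorem** `face_comm`: for every one of the `2⁴` kind patterns compatible with the
  surgery relations, the sum over intermediate labellings along the two paths of the face agree.
  Only six patterns are consistent (merge/merge twice — associativity; split/split twice —
  coassociativity; merge–split both ways — `Δ ∘ m`; split–merge both ways — `m ∘ Δ`, the genus-one
  face; split–merge against merge–split — the Frobenius identity `Δ(a)·d = Δ(a·d)`); the other ten
  contradict the surgery relations.

No planarity and no Gauss diagram appear here; the file is used by `KhComplexFaceProofs`.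

## Sources

* M. Khovanov, *A categorification of the Jones polynomial*, Duke Math. J. 101 (2000) 359–426,
  §2.2–2.3 (the Frobenius algebra `A`, functoriality of `F`), Prop. 8.
* M. Khovanov, *Link homology and Frobenius extensions*, Fund. Math. 190 (2006) 179–190, §2
  (the universal rank-two system `X² = hX + t`).
* D. Bar-Natan, *On Khovanov's categorification of the Jones polynomial*, Algebr. Geom. Topol. 2
  (2002) 337–370, §3.2.
* O. Viro, *Khovanov homology, its definitions and ramifications*, Fund. Math. 184 (2004)
  317–342, §5.2 (incidence numbers of enhanced states).

## Design

Circle maps take values in arbitrary types with decidable equality (in the application,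
`GaussDiagram.StateCircle τ` for four different states `τ`), so partitions are compared only
through the relations `c x = c y`. Sums over intermediate labellings are first collapsed to sums
over `Bool` (`sum_mergeInc_mul`, `sum_splitInc_mul`), then each face pattern is a short computation
with the tables.
-/

open Finset

noncomputable section

namespace Literature.Topology.FourManifolds

namespace KhFace

variable {X : Type*}
variable (R : Type) [CommRing R] (h t : R)

/-! ## Labellings, surgery relation, incidence numbers -/

/-- **Labellings** of the classes of a circle map `c : X → Y` by the basis `1 ↔ false`,
`X ↔ true`: functions on `X` constant on the fibres of `c` (cf. `GaussDiagram.EnhancedState`).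
Viro (2004), §5.1. [cite: Viro2004] -/
abbrev Lab {Y : Type*} (c : X → Y) : Type _ :=
  {f : X → Bool // ∀ x y, c x = c y → f x = f y}

/-- **Surgery relation** between two circle maps: `c'` is obtained from `c` by uniting the two
*distinct* classes of `α` and `β` (a merge read from `c` to `c'`, a split read from `c'` to `c`).
For Gauss diagrams this is the content of `GaussDiagram.IsMergeAt.reachable_update_iff` /
`GaussDiagram.IsSplitAt.reachable_iff` (`KhFlipReach`). Bar-Natan (2002), §3.1. [folklore] -/
structure Surg {Y Y' : Type*} (c : X → Y) (c' : X → Y') (α β : X) : Prop where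
  /-- The two classes united are distinct. -/
  ne : c α ≠ c β
  /-- Classes of `c'` are classes of `c`, except that those of `α` and `β` are united. -/
  rel : ∀ x y, c' x = c' y ↔ c x = c y ∨ ((c x = c α ∨ c x = c β) ∧ (c y = c α ∨ c y = c β))

/-- The unsigned **incidence number of a merge** edge towards the circle map `c'` (the circles
after the merge): zero unless the new labelling `mu` agrees with the old one `la` off the merged
circle (the `c'`-class of `α`), and then the multiplication table entry
`mergeCoeff (la α) (la β) (mu α)`. Transcription of the merge branch of
`GaussDiagram.incidence`. Viro (2004), §5.2. [cite: Viro2004] -/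
def mergeInc [Fintype X] {Y' : Type*} [DecidableEq Y'] (c' : X → Y') (la mu : X → Bool)
    (α β : X) : R :=
  if ∀ x, c' x ≠ c' α → mu x = la x then GaussDiagram.mergeCoeff R h t (la α) (la β) (mu α)
  else 0

/-- The unsigned **incidence number of a split** edge from the circle map `c` (the circles before
the split): zero unless the new labelling agrees with the old one off the split circle (the
`c`-class of `α`), and then the comultiplication table entry `splitCoeff (la α) (mu α) (mu β)`.
Transcription of the split branch of `GaussDiagram.incidence`. Viro (2004), §5.2. [cite: Viro2004] -/
def splitInc [Fintype X] {Y : Type*} [DecidableEq Y] (c : X → Y) (la mu : X → Bool)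
    (α β : X) : R :=
  if ∀ x, c x ≠ c α → mu x = la x then GaussDiagram.splitCoeff R h t (la α) (mu α) (mu β)
  else 0

/-- The two **kinds** of edges of the cube of resolutions of a knot diagram: merges and splits.
Bar-Natan (2002), §3.1. [cite: BarNatan2002] -/
inductive Kind
  /-- Two circles merge into one. -/
  | merge
  /-- One circle splits into two. -/
  | split
  deriving DecidableEq

/-- The unsigned incidence number of an edge of kind `k` from circle map `c` to circle map `c'`
with local strands `α`, `β`. [folklore] -/
def edgeVal [Fintype X] {Y Y' : Type*} [DecidableEq Y] [DecidableEq Y'] (k : Kind) (c : X → Y)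
    (c' : X → Y') (la mu : X → Bool) (α β : X) : R :=
  match k with
  | .merge => mergeInc R h t c' la mu α β
  | .split => splitInc R h t c la mu α β

/-- The surgery relation of an edge of kind `k` from `c` to `c'` at the strands `α`, `β`: a merge
unites the `c`-classes of `α`, `β`; a split is a merge read backwards. [folklore] -/
def EdgeOK {Y Y' : Type*} (k : Kind) (c : X → Y) (c' : X → Y') (α β : X) : Prop :=
  match k with
  | .merge => Surg c c' α β
  | .split => Surg c' c α β

variable {R h t}

/-! ## Elementary consequences of the surgery relation -/

namespace Surg

variable {Y Y' : Type*} {c : X → Y} {c' : X → Y'} {α β : X}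

/-- After the surgery the two strands lie on one class. [folklore] -/
theorem eq (S : Surg c c' α β) : c' α = c' β :=
  (S.rel α β).mpr (Or.inr ⟨Or.inl rfl, Or.inr rfl⟩)

/-- The finer map refines the coarser one. [folklore] -/
theorem le (S : Surg c c' α β) {x y : X} (hxy : c x = c y) : c' x = c' y :=
  (S.rel x y).mpr (Or.inl hxy)

/-- The united class is the union of the two old classes. [folklore] -/
theorem eq_iff (S : Surg c c' α β) (x : X) : c' x = c' α ↔ c x = c α ∨ c x = c β := by
  rw [S.rel]
  constructor
  · rintro (hx | ⟨hx, -⟩)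
    · exact Or.inl hx
    · exact hx
  · intro hx
    exact Or.inr ⟨hx, Or.inl rfl⟩

/-- The united class, seen from `β`. [folklore] -/
theorem eq_iff' (S : Surg c c' α β) (x : X) : c' x = c' β ↔ c x = c α ∨ c x = c β := by
  rw [← S.eq, S.eq_iff]

/-- Off the united class nothing changes. [folklore] -/
theorem eq_iff_of_not (S : Surg c c' α β) {x : X} (hx : c' x ≠ c' α) (y : X) :
    c' x = c' y ↔ c x = c y := by
  rw [S.rel]
  constructor
  · rintro (h | ⟨h, -⟩)
    · exact h
    · exact absurd ((S.eq_iff x).mpr h) hx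
  · exact Or.inl

/-- Off the united class nothing changes (hypothesis on the second point, before the surgery).
[folklore] -/
theorem eq_iff_of_ne (S : Surg c c' α β) (x : X) {y : X} (hy : c y ≠ c α) (hy' : c y ≠ c β) :
    c' x = c' y ↔ c x = c y := by
  rw [S.rel]
  constructor
  · rintro (h | ⟨-, h | h⟩)
    · exact h
    · exact absurd h hy
    · exact absurd h hy'
  · exact Or.inl

/-- Off the united class nothing changes (hypothesis on the second point, after the surgery).
[folklore] -/
theorem eq_iff_of_ne' (S : Surg c c' α β) (x : X) {y : X} (hy : c' y ≠ c' α) :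
    c' x = c' y ↔ c x = c y := by
  rw [S.rel]
  constructor
  · rintro (h | ⟨-, h | h⟩)
    · exact h
    · exact absurd (S.le h) hy
    · exact absurd ((S.le h).trans S.eq.symm) hy
  · exact Or.inl

/-- The surgery relation is symmetric in the two strands. [folklore] -/
theorem symm (S : Surg c c' α β) : Surg c c' β α :=
  ⟨fun h' ↦ S.ne h'.symm, fun x y ↦ (S.rel x y).trans (or_congr_right (and_congr or_comm or_comm))⟩

end Surg

/-! ## Updating a labelling on one class -/

/-- Change a labelling to the value `v` on the `c`-class of `a`. [folklore] -/
def upd {Y : Type*} [DecidableEq Y] (c : X → Y) (f : X → Bool) (a : X) (v : Bool) : X → Bool :=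
  fun x ↦ if c x = c a then v else f x

section Upd

variable {Y : Type*} [DecidableEq Y] {c : X → Y} {f : X → Bool} {a : X} {v : Bool}

/-- Value of the updated labelling on the class of `a`. [folklore] -/
theorem upd_of_eq {x : X} (hx : c x = c a) : upd c f a v x = v := if_pos hx

/-- Value of the updated labelling off the class of `a`. [folklore] -/
theorem upd_of_ne {x : X} (hx : c x ≠ c a) : upd c f a v x = f x := if_neg hx

/-- Value of the updated labelling at `a`. [folklore] -/
@[simp]
theorem upd_self : upd c f a v a = v := if_pos rfl

/-- A comparison `nu = upd c f a v` on a region avoiding the class of `a` does not see the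
update. [folklore] -/
theorem forall_upd_of_forall_not {nu : X → Bool} {Q : X → Prop} (hQ : ∀ x, c x = c a → ¬ Q x) :
    (∀ x, Q x → nu x = upd c f a v x) ↔ ∀ x, Q x → nu x = f x := by
  refine forall_congr' fun x ↦ imp_congr_right fun hx ↦ ?_
  rw [upd_of_ne fun hc ↦ hQ x hc hx]

/-- A comparison `nu = upd c f a v` on a region containing the class of `a`, for `nu` constant on
that class, pins `v` to `nu a`. [folklore] -/
theorem forall_upd_of_forall {nu : X → Bool} {Q : X → Prop} (hQ : ∀ x, c x = c a → Q x)
    (hnu : ∀ x, c x = c a → nu x = nu a) :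
    (∀ x, Q x → nu x = upd c f a v x) ↔ v = nu a ∧ ∀ x, (Q x ∧ c x ≠ c a) → nu x = f x := by
  constructor
  · intro H
    refine ⟨?_, fun x hx ↦ ?_⟩
    · have := H a (hQ a rfl)
      rw [upd_self] at this
      exact this.symm
    · rw [← upd_of_ne (f := f) (v := v) hx.2]
      exact H x hx.1
  · rintro ⟨rfl, H⟩ x hx
    by_cases hc : c x = c a
    · rw [upd_of_eq hc, hnu x hc]
    · rw [upd_of_ne hc]
      exact H x ⟨hx, hc⟩

end Upd

/-! ## Collapsing the sum over intermediate labellings -/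

section Transfer

variable {Y Y' : Type*} [DecidableEq Y'] {c : X → Y} {c' : X → Y'} {α β : X}

/-- After a merge, updating an old labelling on the merged class gives a labelling of the new
circles. [folklore] -/
theorem upd_mem_lab (S : Surg c c' α β) (la : Lab c) (v : Bool) :
    ∀ x y, c' x = c' y → upd c' la.1 α v x = upd c' la.1 α v y := by
  intro x y hxy
  by_cases hx : c' x = c' α
  · rw [upd_of_eq hx, upd_of_eq (hxy ▸ hx)]
  · have hy : c' y ≠ c' α := fun hy ↦ hx (hxy.trans hy)
    rw [upd_of_ne hx, upd_of_ne hy]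
    exact la.2 x y ((S.eq_iff_of_not hx y).mp hxy)

/-- The labelling of the merged circles obtained by putting `v` on the merged class. [folklore] -/
def updLab (S : Surg c c' α β) (la : Lab c) (v : Bool) : Lab c' :=
  ⟨upd c' la.1 α v, upd_mem_lab S la v⟩

/-- A labelling of the merged circles agrees with `la` off the merged class iff it is `la`
updated on that class. [folklore] -/
theorem forall_iff_eq_upd (la : Lab c) (mu : Lab c') :
    (∀ x, c' x ≠ c' α → mu.1 x = la.1 x) ↔ mu.1 = upd c' la.1 α (mu.1 α) := by
  constructor
  · intro H
    funext x
    by_cases hx : c' x = c' α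
    · rw [upd_of_eq hx, mu.2 x α hx]
    · rw [upd_of_ne hx, H x hx]
  · intro H x hx
    rw [H, upd_of_ne hx]

/-- **Collapsing a merge.** The sum over all labellings `mu` of the merged circles of
`mergeInc · la mu · F mu` reduces to the sum over the label `v` of the merged circle.
Viro (2004), §5.2. [folklore] -/
theorem sum_mergeInc_mul [Fintype X] [DecidableEq X] (S : Surg c c' α β) (la : Lab c)
    (F : (X → Bool) → R) :
    ∑ mu : Lab c', mergeInc R h t c' la.1 mu.1 α β * F mu.1 =
      ∑ v : Bool, GaussDiagram.mergeCoeff R h t (la.1 α) (la.1 β) v * F (upd c' la.1 α v) := by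
  classical
  have key : ∀ mu : Lab c', mergeInc R h t c' la.1 mu.1 α β * F mu.1 =
      ∑ v : Bool, if mu = updLab S la v then
        GaussDiagram.mergeCoeff R h t (la.1 α) (la.1 β) v * F (upd c' la.1 α v) else 0 := by
    intro mu
    have hmu : ∀ v, mu = updLab S la v ↔ (mu.1 = upd c' la.1 α (mu.1 α) ∧ mu.1 α = v) := by
      intro v
      constructor
      · rintro rfl
        exact ⟨by simp [updLab], by simp [updLab]⟩
      · rintro ⟨h1, rfl⟩
        exact Subtype.ext h1
    unfold mergeInc
    by_cases H : ∀ x, c' x ≠ c' α → mu.1 x = la.1 x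
    · rw [if_pos H]
      have H' := (forall_iff_eq_upd la mu).mp H
      rw [Finset.sum_eq_single (mu.1 α)]
      · rw [if_pos ((hmu _).mpr ⟨H', rfl⟩), ← H']
      · intro v _ hv
        rw [if_neg]
        intro h'
        exact hv ((hmu v).mp h').2.symm
      · intro h'
        exact absurd (Finset.mem_univ _) h'
    · rw [if_neg H, zero_mul]
      symm
      refine Finset.sum_eq_zero fun v _ ↦ ?_
      rw [if_neg]
      intro h'
      exact H ((forall_iff_eq_upd la mu).mpr ((hmu v).mp h').1)
  simp_rw [key]
  rw [Finset.sum_comm]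
  refine Finset.sum_congr rfl fun v _ ↦ ?_
  rw [Finset.sum_eq_single (updLab S la v) (fun mu _ hmu ↦ if_neg hmu)
    (fun h' ↦ absurd (Finset.mem_univ _) h'), if_pos rfl]

/-- After a split, updating an old labelling on the two new classes gives a labelling of the new
circles. [folklore] -/
theorem upd_upd_mem_lab (S : Surg c' c α β) (la : Lab c) (v w : Bool) :
    ∀ x y, c' x = c' y → upd c' (upd c' la.1 β w) α v x = upd c' (upd c' la.1 β w) α v y := by
  intro x y hxy
  by_cases hx : c' x = c' α
  · rw [upd_of_eq hx, upd_of_eq (hxy ▸ hx)]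
  · have hy : c' y ≠ c' α := fun hy ↦ hx (hxy.trans hy)
    rw [upd_of_ne hx, upd_of_ne hy]
    by_cases hx' : c' x = c' β
    · rw [upd_of_eq hx', upd_of_eq (hxy ▸ hx')]
    · have hy' : c' y ≠ c' β := fun hy' ↦ hx' (hxy.trans hy')
      rw [upd_of_ne hx', upd_of_ne hy']
      exact la.2 x y (S.le hxy)

/-- The labelling of the split circles obtained by putting `v`, `w` on the two new classes.
[folklore] -/
def updLab₂ (S : Surg c' c α β) (la : Lab c) (v w : Bool) : Lab c' :=
  ⟨upd c' (upd c' la.1 β w) α v, upd_upd_mem_lab S la v w⟩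

/-- A labelling of the split circles agrees with `la` off the split circle iff it is `la` updated
on the two new classes. [folklore] -/
theorem forall_iff_eq_upd_upd (S : Surg c' c α β) (la : Lab c) (mu : Lab c') :
    (∀ x, c x ≠ c α → mu.1 x = la.1 x) ↔ mu.1 = upd c' (upd c' la.1 β (mu.1 β)) α (mu.1 α) := by
  constructor
  · intro H
    funext x
    by_cases hx : c' x = c' α
    · rw [upd_of_eq hx, mu.2 x α hx]
    · rw [upd_of_ne hx]
      by_cases hx' : c' x = c' β
      · rw [upd_of_eq hx', mu.2 x β hx']
      · rw [upd_of_ne hx']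
        refine H x fun h' ↦ ?_
        rcases (S.eq_iff x).mp h' with h'' | h''
        · exact hx h''
        · exact hx' h''
  · intro H x hx
    have hxa : c' x ≠ c' α := fun h' ↦ hx (S.le h')
    have hxb : c' x ≠ c' β := fun h' ↦ hx ((S.le h').trans S.eq.symm)
    rw [H, upd_of_ne hxa, upd_of_ne hxb]

/-- **Collapsing a split.** The sum over all labellings `mu` of the split circles of
`splitInc · la mu · F mu` reduces to the sum over the labels `v`, `w` of the two new circles.
Viro (2004), §5.2. [folklore] -/
theorem sum_splitInc_mul [Fintype X] [DecidableEq X] [DecidableEq Y] (S : Surg c' c α β)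
    (la : Lab c) (F : (X → Bool) → R) :
    ∑ mu : Lab c', splitInc R h t c la.1 mu.1 α β * F mu.1 =
      ∑ v : Bool, ∑ w : Bool, GaussDiagram.splitCoeff R h t (la.1 α) v w *
        F (upd c' (upd c' la.1 β w) α v) := by
  classical
  have hba : c' β ≠ c' α := fun h' ↦ S.ne h'.symm
  have key : ∀ mu : Lab c', splitInc R h t c la.1 mu.1 α β * F mu.1 =
      ∑ v : Bool, ∑ w : Bool, if mu = updLab₂ S la v w then
        GaussDiagram.splitCoeff R h t (la.1 α) v w * F (upd c' (upd c' la.1 β w) α v) else 0 := by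
    intro mu
    have hmu : ∀ v w, mu = updLab₂ S la v w ↔
        (mu.1 = upd c' (upd c' la.1 β (mu.1 β)) α (mu.1 α) ∧ mu.1 α = v ∧ mu.1 β = w) := by
      intro v w
      constructor
      · rintro rfl
        refine ⟨?_, by simp [updLab₂], by simp [updLab₂, upd_of_ne hba]⟩
        simp [updLab₂, upd_of_ne hba]
      · rintro ⟨h1, rfl, rfl⟩
        exact Subtype.ext h1
    unfold splitInc
    by_cases H : ∀ x, c x ≠ c α → mu.1 x = la.1 x
    · rw [if_pos H]
      have H' := (forall_iff_eq_upd_upd S la mu).mp H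
      rw [Finset.sum_eq_single (mu.1 α), Finset.sum_eq_single (mu.1 β)]
      · rw [if_pos ((hmu _ _).mpr ⟨H', rfl, rfl⟩), ← H']
      · intro w _ hw
        rw [if_neg]
        intro h'
        exact hw ((hmu _ _).mp h').2.2.symm
      · intro h'
        exact absurd (Finset.mem_univ _) h'
      · intro v _ hv
        refine Finset.sum_eq_zero fun w _ ↦ ?_
        rw [if_neg]
        intro h'
        exact hv ((hmu _ _).mp h').2.1.symm
      · intro h'
        exact absurd (Finset.mem_univ _) h'
    · rw [if_neg H, zero_mul]
      symm
      refine Finset.sum_eq_zero fun v _ ↦ Finset.sum_eq_zero fun w _ ↦ ?_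
      rw [if_neg]
      intro h'
      exact H ((forall_iff_eq_upd_upd S la mu).mpr ((hmu v w).mp h').1)
  simp_rw [key]
  rw [Finset.sum_comm]
  refine Finset.sum_congr rfl fun v _ ↦ ?_
  rw [Finset.sum_comm]
  refine Finset.sum_congr rfl fun w _ ↦ ?_
  rw [Finset.sum_eq_single (updLab₂ S la v w) (fun mu _ hmu ↦ if_neg hmu)
    (fun h' ↦ absurd (Finset.mem_univ _) h'), if_pos rfl]

end Transfer

/-! ## Identities of the tables of `A = R[X]/(X² - hX - t)` -/

section Algebra

open GaussDiagram

/-- The multiplication of `A` is commutative. Khovanov (2006), §2. [cite: Khovanov2006] -/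
theorem mergeCoeff_comm (a b c : Bool) : mergeCoeff R h t a b c = mergeCoeff R h t b a c := by
  cases a <;> cases b <;> cases c <;> rfl

/-- The comultiplication of `A` is cocommutative. Khovanov (2006), §2. [cite: Khovanov2006] -/
theorem splitCoeff_comm (a b c : Bool) : splitCoeff R h t a b c = splitCoeff R h t a c b := by
  cases a <;> cases b <;> cases c <;> rfl

/-- Associativity with commutativity of `A`: the coefficient of `z` in the triple product is
symmetric under exchanging the last two factors, `(ab)d = (ad)b`. Khovanov (2006), §2. [cite: Khovanov2006] -/
theorem sum_mergeCoeff_mergeCoeff_swap (a b d z : Bool) :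
    ∑ v : Bool, mergeCoeff R h t a b v * mergeCoeff R h t v d z =
      ∑ v : Bool, mergeCoeff R h t a d v * mergeCoeff R h t v b z := by
  simp only [Fintype.sum_bool]
  cases a <;> cases b <;> cases d <;> cases z <;> simp [mergeCoeff, mul_comm]

/-- Associativity with commutativity of `A`: cyclic symmetry of the triple product,
`(ab)d = (bd)a`. Khovanov (2006), §2. [cite: Khovanov2006] -/
theorem sum_mergeCoeff_mergeCoeff_cycle (a b d z : Bool) :
    ∑ v : Bool, mergeCoeff R h t a b v * mergeCoeff R h t v d z =
      ∑ v : Bool, mergeCoeff R h t b d v * mergeCoeff R h t v a z := by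
  simp only [Fintype.sum_bool]
  cases a <;> cases b <;> cases d <;> cases z <;> simp [mergeCoeff, mul_comm]

/-- Coassociativity with cocommutativity of `A`: the coefficient of `a ⊗ b ⊗ d` in the double
coproduct of `z` is symmetric under exchanging the first two outputs. Khovanov (2006), §2. [cite: Khovanov2006] -/
theorem sum_splitCoeff_splitCoeff_swap (z a b d : Bool) :
    ∑ u : Bool, splitCoeff R h t z a u * splitCoeff R h t u b d =
      ∑ u : Bool, splitCoeff R h t z b u * splitCoeff R h t u a d := by
  simp only [Fintype.sum_bool]
  cases z <;> cases a <;> cases b <;> cases d <;> simp [splitCoeff, mul_comm]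

/-- Coassociativity with cocommutativity of `A`: cyclic symmetry of the double coproduct.
Khovanov (2006), §2. [cite: Khovanov2006] -/
theorem sum_splitCoeff_splitCoeff_cycle (z a b d : Bool) :
    ∑ u : Bool, splitCoeff R h t z a u * splitCoeff R h t u b d =
      ∑ u : Bool, splitCoeff R h t z b u * splitCoeff R h t u d a := by
  simp only [Fintype.sum_bool]
  cases z <;> cases a <;> cases b <;> cases d <;> simp [splitCoeff, mul_comm]

/-- **The Frobenius identity** `Δ(a)·d = Δ(a·d)` of `A` (the coproduct is a map of
`A`-modules), in coordinates: splitting `a` into `(u, y)` and multiplying `u` by `d` gives the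
same as multiplying `a` by `d` and splitting the product into `(z, y)`. Khovanov (2000), §2.2,
formula (16); Khovanov (2006), §2. [cite: Khovanov2006] -/
theorem sum_splitCoeff_mergeCoeff (a d y z : Bool) :
    ∑ u : Bool, splitCoeff R h t a u y * mergeCoeff R h t u d z =
      ∑ v : Bool, mergeCoeff R h t a d v * splitCoeff R h t v z y := by
  simp only [Fintype.sum_bool]
  cases a <;> cases d <;> cases y <;> cases z <;> simp [splitCoeff, mergeCoeff, mul_comm, add_comm]

/-- Pulling a condition out of a sum over `Bool`. [folklore] -/
theorem sum_mul_ite (f g : Bool → R) (P : Prop) [Decidable P] :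
    ∑ v : Bool, f v * (if P then g v else 0) = if P then ∑ v : Bool, f v * g v else 0 := by
  split_ifs <;> simp

/-- A sum over `Bool` against a condition pinning the variable. [folklore] -/
theorem sum_mul_ite_eq_and (f g : Bool → R) (b : Bool) (P : Prop) [Decidable P] :
    ∑ v : Bool, f v * (if v = b ∧ P then g v else 0) = if P then f b * g b else 0 := by
  by_cases hP : P
  · simp only [hP, and_true, if_true, Fintype.sum_bool]
    cases b <;> simp
  · simp [hP]

/-- Coassociativity with cocommutativity of `A`: exchanging one output of each of the two
coproducts. Khovanov (2006), §2. [cite: Khovanov2006] -/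
theorem sum_splitCoeff_splitCoeff_swap' (z p q r : Bool) :
    ∑ u : Bool, splitCoeff R h t z u q * splitCoeff R h t u p r =
      ∑ u : Bool, splitCoeff R h t z u r * splitCoeff R h t u p q := by
  simp only [Fintype.sum_bool]
  cases z <;> cases p <;> cases q <;> cases r <;> simp [splitCoeff, mul_comm]

/-- A double sum over `Bool` against a condition pinning the inner variable. [folklore] -/
theorem sum_sum_mul_ite_eq_and_right (f g : Bool → Bool → R) (b : Bool) (P : Prop)
    [Decidable P] :
    ∑ v : Bool, ∑ w : Bool, f v w * (if w = b ∧ P then g v w else 0) =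
      if P then ∑ v : Bool, f v b * g v b else 0 := by
  by_cases hP : P
  · simp only [hP, and_true, if_true, Fintype.sum_bool]
    cases b <;> simp
  · simp [hP]

/-- A double sum over `Bool` against a condition pinning both variables. [folklore] -/
theorem sum_sum_mul_ite_eq_and (f g : Bool → Bool → R) (a b : Bool) (P : Prop) [Decidable P] :
    ∑ v : Bool, ∑ w : Bool, f v w * (if v = a ∧ (w = b ∧ P) then g v w else 0) =
      if P then f a b * g a b else 0 := by
  by_cases hP : P
  · simp only [hP, and_true, if_true, Fintype.sum_bool]
    cases a <;> cases b <;> simp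
  · simp [hP]

end Algebra

/-! ## The six consistent faces -/

section Faces

variable [Fintype X] [DecidableEq X] {Y₀ Y₁ Y₂ Y₃ : Type*} [DecidableEq Y₀] [DecidableEq Y₁]
  [DecidableEq Y₂] [DecidableEq Y₃] {c₀₀ : X → Y₀} {c₁₀ : X → Y₁} {c₀₁ : X → Y₂} {c₁₁ : X → Y₃}
  {α β α' β' : X}

open GaussDiagram

omit [DecidableEq X] [DecidableEq Y₀] [DecidableEq Y₁] [DecidableEq Y₂] [DecidableEq Y₃] in
/-- A merge incidence number is symmetric in the two strands. [folklore] -/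
theorem mergeInc_swap {Y' : Type*} [DecidableEq Y'] {c' : X → Y'} {a b : X} (hc : c' a = c' b)
    (la : X → Bool) (mu : Lab c') :
    mergeInc R h t c' la mu.1 b a = mergeInc R h t c' la mu.1 a b := by
  unfold mergeInc
  rw [← hc, mu.2 b a hc.symm, mergeCoeff_comm]

omit [DecidableEq X] [DecidableEq Y₀] [DecidableEq Y₁] [DecidableEq Y₂] [DecidableEq Y₃] in
/-- A split incidence number is symmetric in the two strands. [folklore] -/
theorem splitInc_swap {Y : Type*} [DecidableEq Y] {c : X → Y} {a b : X} (hc : c a = c b)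
    (la : Lab c) (mu : X → Bool) :
    splitInc R h t c la.1 mu b a = splitInc R h t c la.1 mu a b := by
  unfold splitInc
  rw [← hc, la.2 b a hc.symm, splitCoeff_comm]

omit [DecidableEq Y₀] in
/-- Face merge–merge, disjoint case: the two chords join two disjoint pairs of circles; the two
merges commute. Khovanov (2000), Prop. 8. [cite: Khovanov2000] -/
theorem face_MM_MM_disjoint (S₁ : Surg c₀₀ c₁₀ α β) (S₂ : Surg c₁₀ c₁₁ α' β')
    (S₃ : Surg c₀₀ c₀₁ α' β') (S₄ : Surg c₀₁ c₁₁ α β)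
    (hα' : c₁₀ α' ≠ c₁₀ α) (hβ' : c₁₀ β' ≠ c₁₀ α) (la : Lab c₀₀) (nu : Lab c₁₁) :
    ∑ mu : Lab c₁₀, mergeInc R h t c₁₀ la.1 mu.1 α β * mergeInc R h t c₁₁ mu.1 nu.1 α' β' =
      ∑ mu : Lab c₀₁, mergeInc R h t c₀₁ la.1 mu.1 α' β' * mergeInc R h t c₁₁ mu.1 nu.1 α β := by
  classical
  -- geometry: the four circles of `c₀₀` through `α, β, α', β'` are distinct
  have hα : c₀₁ α ≠ c₀₁ α' := fun h' ↦ by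
    rcases (S₃.eq_iff α).mp h' with h'' | h''
    · exact hα' ((S₁.eq_iff α').mpr (Or.inl h''.symm))
    · exact hβ' ((S₁.eq_iff β').mpr (Or.inl h''.symm))
  have hβ : c₀₁ β ≠ c₀₁ α' := fun h' ↦ by
    rcases (S₃.eq_iff β).mp h' with h'' | h''
    · exact hα' ((S₁.eq_iff α').mpr (Or.inr h''.symm))
    · exact hβ' ((S₁.eq_iff β').mpr (Or.inr h''.symm))
  have hK₁ : ∀ x, c₁₀ x = c₁₀ α → c₁₁ x ≠ c₁₁ α' := by
    intro x hx h'
    rcases (S₂.eq_iff x).mp h' with h'' | h''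
    · exact hα' (h''.symm.trans hx)
    · exact hβ' (h''.symm.trans hx)
  have hK₂ : ∀ x, c₀₁ x = c₀₁ α' → c₁₁ x ≠ c₁₁ α := by
    intro x hx h'
    rcases (S₄.eq_iff x).mp h' with h'' | h''
    · exact hα (h''.symm.trans hx)
    · exact hβ (h''.symm.trans hx)
  have hZ₁ : ∀ x, c₁₀ x = c₁₀ α ↔ c₁₁ x = c₁₁ α := fun x ↦
    (S₂.eq_iff_of_ne x (fun h' ↦ hα' h'.symm) fun h' ↦ hβ' h'.symm).symm
  have hZ₂ : ∀ x, c₀₁ x = c₀₁ α' ↔ c₁₁ x = c₁₁ α' := fun x ↦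
    (S₄.eq_iff_of_ne x (fun h' ↦ hα h'.symm) fun h' ↦ hβ h'.symm).symm
  rw [sum_mergeInc_mul S₁ la (fun f ↦ mergeInc R h t c₁₁ f nu.1 α' β'),
    sum_mergeInc_mul S₃ la (fun f ↦ mergeInc R h t c₁₁ f nu.1 α β)]
  simp only [mergeInc]
  have hb₁ : ∀ v, (∀ x, c₁₁ x ≠ c₁₁ α' → nu.1 x = upd c₁₀ la.1 α v x) ↔
      v = nu.1 α ∧ ∀ x, (c₁₁ x ≠ c₁₁ α' ∧ c₁₁ x ≠ c₁₁ α) → nu.1 x = la.1 x := fun v ↦ by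
    rw [forall_upd_of_forall (Q := fun x ↦ c₁₁ x ≠ c₁₁ α') hK₁ fun x hx ↦ nu.2 x α (S₂.le hx)]
    simp only [ne_eq, hZ₁]
  have hb₂ : ∀ v, (∀ x, c₁₁ x ≠ c₁₁ α → nu.1 x = upd c₀₁ la.1 α' v x) ↔
      v = nu.1 α' ∧ ∀ x, (c₁₁ x ≠ c₁₁ α' ∧ c₁₁ x ≠ c₁₁ α) → nu.1 x = la.1 x := fun v ↦ by
    rw [forall_upd_of_forall (Q := fun x ↦ c₁₁ x ≠ c₁₁ α) hK₂ fun x hx ↦ nu.2 x α' (S₄.le hx)]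
    simp only [ne_eq, hZ₂, and_comm]
  simp only [hb₁, hb₂, upd_of_ne hα', upd_of_ne hβ', upd_of_ne hα, upd_of_ne hβ,
    sum_mul_ite_eq_and]
  split_ifs
  · exact mul_comm _ _
  · rfl

omit [DecidableEq Y₀] in
/-- Face merge–merge, overlapping case: chord `i` joins the circles `A ∋ α`, `B ∋ β`, chord `j`
joins `A ∋ α'` and a third circle `∋ β'`; associativity (and commutativity) of `A`.
Khovanov (2000), Prop. 8. [cite: Khovanov2000] -/
theorem face_MM_MM_of_eq (S₁ : Surg c₀₀ c₁₀ α β) (S₂ : Surg c₁₀ c₁₁ α' β')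
    (S₃ : Surg c₀₀ c₀₁ α' β') (S₄ : Surg c₀₁ c₁₁ α β) (hO : c₀₀ α' = c₀₀ α) (la : Lab c₀₀)
    (nu : Lab c₁₁) :
    ∑ mu : Lab c₁₀, mergeInc R h t c₁₀ la.1 mu.1 α β * mergeInc R h t c₁₁ mu.1 nu.1 α' β' =
      ∑ mu : Lab c₀₁, mergeInc R h t c₀₁ la.1 mu.1 α' β' * mergeInc R h t c₁₁ mu.1 nu.1 α β := by
  classical
  have hZ₁ : c₁₀ α' = c₁₀ α := (S₁.eq_iff α').mpr (Or.inl hO)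
  have hβ' : c₁₀ β' ≠ c₁₀ α := fun h' ↦ S₂.ne (hZ₁.trans h'.symm)
  have hZ₂ : c₀₁ α = c₀₁ α' := (S₃.eq_iff α).mpr (Or.inl hO.symm)
  have hβ : c₀₁ β ≠ c₀₁ α' := fun h' ↦ S₄.ne (hZ₂.trans h'.symm)
  have hK : c₁₁ α = c₁₁ α' := S₂.le hZ₁.symm
  rw [sum_mergeInc_mul S₁ la (fun f ↦ mergeInc R h t c₁₁ f nu.1 α' β'),
    sum_mergeInc_mul S₃ la (fun f ↦ mergeInc R h t c₁₁ f nu.1 α β)]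
  simp only [mergeInc]
  have hb₁ : ∀ v, (∀ x, c₁₁ x ≠ c₁₁ α' → nu.1 x = upd c₁₀ la.1 α v x) ↔
      ∀ x, c₁₁ x ≠ c₁₁ α' → nu.1 x = la.1 x := fun v ↦
    forall_upd_of_forall_not (Q := fun x ↦ c₁₁ x ≠ c₁₁ α') fun x hx h' ↦
      h' ((S₂.le hx).trans hK)
  have hb₂ : ∀ v, (∀ x, c₁₁ x ≠ c₁₁ α → nu.1 x = upd c₀₁ la.1 α' v x) ↔
      ∀ x, c₁₁ x ≠ c₁₁ α' → nu.1 x = la.1 x := fun v ↦ by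
    rw [forall_upd_of_forall_not (Q := fun x ↦ c₁₁ x ≠ c₁₁ α) fun x hx h' ↦
      h' ((S₄.le hx).trans hK.symm), hK]
  simp only [hb₁, hb₂, upd_of_eq hZ₁, upd_of_ne hβ', upd_of_eq hZ₂, upd_of_ne hβ, sum_mul_ite]
  split_ifs
  · rw [la.2 _ _ hO, nu.2 _ _ hK]
    exact sum_mergeCoeff_mergeCoeff_swap _ _ _ _
  · rfl

omit [DecidableEq Y₀] in
/-- **Face merge–merge / merge–merge** (`3 → 2 → 1` circles or two disjoint merges):
associativity and commutativity of `A`. Khovanov (2000), Prop. 8. [cite: Khovanov2000] -/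
theorem face_MM_MM (S₁ : Surg c₀₀ c₁₀ α β) (S₂ : Surg c₁₀ c₁₁ α' β') (S₃ : Surg c₀₀ c₀₁ α' β')
    (S₄ : Surg c₀₁ c₁₁ α β) (la : Lab c₀₀) (nu : Lab c₁₁) :
    ∑ mu : Lab c₁₀, mergeInc R h t c₁₀ la.1 mu.1 α β * mergeInc R h t c₁₁ mu.1 nu.1 α' β' =
      ∑ mu : Lab c₀₁, mergeInc R h t c₀₁ la.1 mu.1 α' β' * mergeInc R h t c₁₁ mu.1 nu.1 α β := by
  by_cases hα' : c₁₀ α' = c₁₀ α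
  · rcases (S₁.eq_iff α').mp hα' with hO | hO
    · exact face_MM_MM_of_eq S₁ S₂ S₃ S₄ hO la nu
    · -- `α'` on the circle of `β`: exchange the roles of `α` and `β`
      have := face_MM_MM_of_eq (R := R) (h := h) (t := t) S₁.symm S₂ S₃ S₄.symm hO la nu
      calc _ = ∑ mu : Lab c₁₀, mergeInc R h t c₁₀ la.1 mu.1 β α *
            mergeInc R h t c₁₁ mu.1 nu.1 α' β' :=
          Finset.sum_congr rfl fun mu _ ↦ by rw [mergeInc_swap S₁.eq]
        _ = _ := this
        _ = _ := Finset.sum_congr rfl fun mu _ ↦ by rw [mergeInc_swap S₄.eq]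
  · by_cases hβ' : c₁₀ β' = c₁₀ α
    · -- `β'` on one of the two circles: exchange the roles of `α'` and `β'`
      rcases (S₁.eq_iff β').mp hβ' with hO | hO
      · have := face_MM_MM_of_eq (R := R) (h := h) (t := t) S₁ S₂.symm S₃.symm S₄ hO la nu
        calc _ = ∑ mu : Lab c₁₀, mergeInc R h t c₁₀ la.1 mu.1 α β *
              mergeInc R h t c₁₁ mu.1 nu.1 β' α' :=
            Finset.sum_congr rfl fun mu _ ↦ by rw [mergeInc_swap S₂.eq]
          _ = _ := this
          _ = _ := Finset.sum_congr rfl fun mu _ ↦ by rw [mergeInc_swap S₃.eq]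
      · have := face_MM_MM_of_eq (R := R) (h := h) (t := t) S₁.symm S₂.symm S₃.symm S₄.symm hO la nu
        calc _ = ∑ mu : Lab c₁₀, mergeInc R h t c₁₀ la.1 mu.1 β α *
              mergeInc R h t c₁₁ mu.1 nu.1 β' α' :=
            Finset.sum_congr rfl fun mu _ ↦ by rw [mergeInc_swap S₁.eq, mergeInc_swap S₂.eq]
          _ = _ := this
          _ = _ := Finset.sum_congr rfl fun mu _ ↦ by
            rw [mergeInc_swap S₃.eq, mergeInc_swap S₄.eq]
    · exact face_MM_MM_disjoint S₁ S₂ S₃ S₄ hα' hβ' la nu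

omit [DecidableEq Y₀] [DecidableEq Y₃] in
/-- **Face merge–split / merge–split** (`2 → 1 → 2` circles both ways, `Δ ∘ m`): both chords join
the same two circles. Khovanov (2000), Prop. 8. [cite: Khovanov2000] -/
theorem face_MS_MS (S₁ : Surg c₀₀ c₁₀ α β) (S₂ : Surg c₁₁ c₁₀ α' β') (S₃ : Surg c₀₀ c₀₁ α' β')
    (S₄ : Surg c₁₁ c₀₁ α β) (la : Lab c₀₀) (nu : Lab c₁₁) :
    ∑ mu : Lab c₁₀, mergeInc R h t c₁₀ la.1 mu.1 α β * splitInc R h t c₁₀ mu.1 nu.1 α' β' =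
      ∑ mu : Lab c₀₁, mergeInc R h t c₀₁ la.1 mu.1 α' β' * splitInc R h t c₀₁ mu.1 nu.1 α β := by
  classical
  -- geometry: `α'`, `β'` lie on the two circles of `c₀₀` through `α`, `β`, one on each
  have h₁ : (c₀₀ α' = c₀₀ α ∧ c₀₀ β' = c₀₀ β) ∨ (c₀₀ α' = c₀₀ β ∧ c₀₀ β' = c₀₀ α) := by
    have h' := (S₁.rel α' β').mp S₂.eq
    rcases h' with h' | ⟨ha | ha, hb | hb⟩
    · exact absurd h' S₃.ne
    · exact absurd (ha.trans hb.symm) S₃.ne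
    · exact Or.inl ⟨ha, hb⟩
    · exact Or.inr ⟨ha, hb⟩
    · exact absurd (ha.trans hb.symm) S₃.ne
  have h₂ : (c₁₁ α = c₁₁ α' ∧ c₁₁ β = c₁₁ β') ∨ (c₁₁ α = c₁₁ β' ∧ c₁₁ β = c₁₁ α') := by
    have h' := (S₂.rel α β).mp S₁.eq
    rcases h' with h' | ⟨ha | ha, hb | hb⟩
    · exact absurd h' S₄.ne
    · exact absurd (ha.trans hb.symm) S₄.ne
    · exact Or.inl ⟨ha, hb⟩
    · exact Or.inr ⟨ha, hb⟩
    · exact absurd (ha.trans hb.symm) S₄.ne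
  have hZ₁ : c₁₀ α' = c₁₀ α := (S₁.eq_iff α').mpr (h₁.elim (fun h ↦ Or.inl h.1) fun h ↦ Or.inr h.1)
  have hZ₂ : c₀₁ α = c₀₁ α' := by
    rw [S₃.eq_iff α]
    rcases h₁ with h | h
    · exact Or.inl h.1.symm
    · exact Or.inr h.2.symm
  have hZ : ∀ x, c₁₀ x = c₁₀ α ↔ c₀₁ x = c₀₁ α' := by
    intro x
    rw [S₁.eq_iff, S₃.eq_iff]
    rcases h₁ with ⟨ha, hb⟩ | ⟨ha, hb⟩
    · rw [ha, hb]
    · rw [ha, hb, or_comm]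
  -- collapse both sides
  rw [sum_mergeInc_mul S₁ la (fun f ↦ splitInc R h t c₁₀ f nu.1 α' β'),
    sum_mergeInc_mul S₃ la (fun f ↦ splitInc R h t c₀₁ f nu.1 α β)]
  simp only [splitInc]
  have hb₁ : ∀ v, (∀ x, c₁₀ x ≠ c₁₀ α' → nu.1 x = upd c₁₀ la.1 α v x) ↔
      ∀ x, c₁₀ x ≠ c₁₀ α' → nu.1 x = la.1 x := fun v ↦
    forall_upd_of_forall_not (Q := fun x ↦ c₁₀ x ≠ c₁₀ α') fun x hx h' ↦ h' (hx.trans hZ₁.symm)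
  have hb₂ : ∀ v, (∀ x, c₀₁ x ≠ c₀₁ α → nu.1 x = upd c₀₁ la.1 α' v x) ↔
      ∀ x, c₁₀ x ≠ c₁₀ α' → nu.1 x = la.1 x := fun v ↦ by
    rw [forall_upd_of_forall_not (Q := fun x ↦ c₀₁ x ≠ c₀₁ α) fun x hx h' ↦ h' (hx.trans hZ₂.symm)]
    refine forall_congr' fun x ↦ ?_
    simp only [ne_eq]
    rw [hZ₁, hZ x, hZ₂]
  simp only [hb₁, hb₂, upd_of_eq hZ₁, upd_of_eq hZ₂, sum_mul_ite]
  split_ifs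
  · rcases h₁ with ⟨ha, hb⟩ | ⟨ha, hb⟩ <;> rcases h₂ with ⟨ha', hb'⟩ | ⟨ha', hb'⟩
    · rw [la.2 _ _ ha, la.2 _ _ hb, nu.2 _ _ ha', nu.2 _ _ hb']
    · rw [la.2 _ _ ha, la.2 _ _ hb, nu.2 _ _ ha', nu.2 _ _ hb']
      exact Finset.sum_congr rfl fun v _ ↦ by rw [splitCoeff_comm]
    · rw [la.2 _ _ ha, la.2 _ _ hb, nu.2 _ _ ha', nu.2 _ _ hb']
      exact Finset.sum_congr rfl fun v _ ↦ by rw [mergeCoeff_comm]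
    · rw [la.2 _ _ ha, la.2 _ _ hb, nu.2 _ _ ha', nu.2 _ _ hb']
      exact Finset.sum_congr rfl fun v _ ↦ by rw [mergeCoeff_comm, splitCoeff_comm]
  · rfl

/-- **Face split–merge / split–merge** (`1 → 2 → 1` circles both ways, `m ∘ Δ`, the genus-one
face): both chords have all four strands on one circle, interlaced. Khovanov (2000), Prop. 8. [cite: Khovanov2000] -/
theorem face_SM_SM (S₁ : Surg c₁₀ c₀₀ α β) (S₂ : Surg c₁₀ c₁₁ α' β') (S₃ : Surg c₀₁ c₀₀ α' β')
    (S₄ : Surg c₀₁ c₁₁ α β) (la : Lab c₀₀) (nu : Lab c₁₁) :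
    ∑ mu : Lab c₁₀, splitInc R h t c₀₀ la.1 mu.1 α β * mergeInc R h t c₁₁ mu.1 nu.1 α' β' =
      ∑ mu : Lab c₀₁, splitInc R h t c₀₀ la.1 mu.1 α' β' * mergeInc R h t c₁₁ mu.1 nu.1 α β := by
  classical
  -- geometry: after the first split, `α'`, `β'` lie on the two new circles, one on each
  have h₁ : (c₁₀ α' = c₁₀ α ∧ c₁₀ β' = c₁₀ β) ∨ (c₁₀ α' = c₁₀ β ∧ c₁₀ β' = c₁₀ α) := by
    have h' := (S₁.rel α' β').mp S₃.eq
    rcases h' with h' | ⟨ha | ha, hb | hb⟩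
    · exact absurd h' S₂.ne
    · exact absurd (ha.trans hb.symm) S₂.ne
    · exact Or.inl ⟨ha, hb⟩
    · exact Or.inr ⟨ha, hb⟩
    · exact absurd (ha.trans hb.symm) S₂.ne
  have h₂ : (c₀₁ α = c₀₁ α' ∧ c₀₁ β = c₀₁ β') ∨ (c₀₁ α = c₀₁ β' ∧ c₀₁ β = c₀₁ α') := by
    have h' := (S₃.rel α β).mp S₁.eq
    rcases h' with h' | ⟨ha | ha, hb | hb⟩
    · exact absurd h' S₄.ne
    · exact absurd (ha.trans hb.symm) S₄.ne
    · exact Or.inl ⟨ha, hb⟩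
    · exact Or.inr ⟨ha, hb⟩
    · exact absurd (ha.trans hb.symm) S₄.ne
  have hK₁ : c₁₁ α = c₁₁ α' :=
    (S₂.eq_iff α).mpr (h₁.elim (fun h ↦ Or.inl h.1.symm) fun h ↦ Or.inr h.2.symm)
  have hKβ : c₁₁ β = c₁₁ α' :=
    (S₂.eq_iff β).mpr (h₁.elim (fun h ↦ Or.inr h.2.symm) fun h ↦ Or.inl h.1.symm)
  have hK₂ : c₀₀ α' = c₀₀ α :=
    (S₁.eq_iff α').mpr (h₁.elim (fun h ↦ Or.inl h.1) fun h ↦ Or.inr h.1)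
  have hba₁ : c₁₀ β ≠ c₁₀ α := fun h' ↦ S₁.ne h'.symm
  have hba₂ : c₀₁ β' ≠ c₀₁ α' := fun h' ↦ S₃.ne h'.symm
  -- collapse both sides
  rw [sum_splitInc_mul S₁ la (fun f ↦ mergeInc R h t c₁₁ f nu.1 α' β'),
    sum_splitInc_mul S₃ la (fun f ↦ mergeInc R h t c₁₁ f nu.1 α β)]
  simp only [mergeInc]
  -- the brackets do not see the updates (both new circles lie inside the merged one)
  have hb₁ : ∀ v w, (∀ x, c₁₁ x ≠ c₁₁ α' → nu.1 x = upd c₁₀ (upd c₁₀ la.1 β w) α v x) ↔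
      ∀ x, c₁₁ x ≠ c₁₁ α' → nu.1 x = la.1 x := fun v w ↦ by
    rw [forall_upd_of_forall_not (Q := fun x ↦ c₁₁ x ≠ c₁₁ α') fun x hx h' ↦
        h' ((S₂.le hx).trans hK₁),
      forall_upd_of_forall_not (Q := fun x ↦ c₁₁ x ≠ c₁₁ α') fun x hx h' ↦
        h' ((S₂.le hx).trans hKβ)]
  have hb₂ : ∀ v w, (∀ x, c₁₁ x ≠ c₁₁ α → nu.1 x = upd c₀₁ (upd c₀₁ la.1 β' w) α' v x) ↔
      ∀ x, c₁₁ x ≠ c₁₁ α' → nu.1 x = la.1 x := fun v w ↦ by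
    rw [forall_upd_of_forall_not (Q := fun x ↦ c₁₁ x ≠ c₁₁ α) fun x hx h' ↦
        h' ((S₄.le hx).trans hK₁.symm),
      forall_upd_of_forall_not (Q := fun x ↦ c₁₁ x ≠ c₁₁ α) fun x hx h' ↦
        h' ((S₄.le hx).trans (S₂.eq.symm.trans hK₁.symm)), hK₁]
  simp only [hb₁, hb₂, sum_mul_ite]
  split_ifs
  · rw [nu.2 _ _ hK₁, la.2 _ _ hK₂]
    rcases h₁ with ⟨ha, hb⟩ | ⟨ha, hb⟩ <;> rcases h₂ with ⟨ha', hb'⟩ | ⟨ha', hb'⟩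
    · simp only [upd_of_eq ha, upd_of_ne (hb.trans_ne hba₁), upd_of_eq hb, upd_of_eq ha',
        upd_of_ne (hb'.trans_ne hba₂), upd_of_eq hb']
    · simp only [upd_of_eq ha, upd_of_ne (hb.trans_ne hba₁), upd_of_eq hb,
        upd_of_ne (ha'.trans_ne hba₂), upd_of_eq ha', upd_of_eq hb', mergeCoeff_comm]
    · simp only [upd_of_ne (ha.trans_ne hba₁), upd_of_eq ha, upd_of_eq hb, upd_of_eq ha',
        upd_of_ne (hb'.trans_ne hba₂), upd_of_eq hb', mergeCoeff_comm]
    · simp only [upd_of_ne (ha.trans_ne hba₁), upd_of_eq ha, upd_of_eq hb,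
        upd_of_ne (ha'.trans_ne hba₂), upd_of_eq ha', upd_of_eq hb']
  · rfl

omit [DecidableEq Y₃] in
/-- Face split–split, disjoint case: the two chords cut two different circles; the two splits
commute. Khovanov (2000), Prop. 8. [cite: Khovanov2000] -/
theorem face_SS_SS_disjoint (S₁ : Surg c₁₀ c₀₀ α β) (S₂ : Surg c₁₁ c₁₀ α' β')
    (S₃ : Surg c₀₁ c₀₀ α' β') (S₄ : Surg c₁₁ c₀₁ α β)
    (hα' : c₁₀ α' ≠ c₁₀ α) (hβ' : c₁₀ α' ≠ c₁₀ β) (la : Lab c₀₀) (nu : Lab c₁₁) :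
    ∑ mu : Lab c₁₀, splitInc R h t c₀₀ la.1 mu.1 α β * splitInc R h t c₁₀ mu.1 nu.1 α' β' =
      ∑ mu : Lab c₀₁, splitInc R h t c₀₀ la.1 mu.1 α' β' * splitInc R h t c₀₁ mu.1 nu.1 α β := by
  classical
  -- geometry: the circles of `c₀₀` through `α` (`∋ β`) and `α'` (`∋ β'`) are different
  have h₀ : c₀₀ α' ≠ c₀₀ α := fun h' ↦ by
    rcases (S₁.eq_iff α').mp h' with h'' | h''
    · exact hα' h''
    · exact hβ' h''
  have hα : c₀₁ α ≠ c₀₁ α' := fun h' ↦ h₀ (S₃.le h').symm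
  have hβ : c₀₁ α ≠ c₀₁ β' := fun h' ↦ h₀ ((S₃.le h').trans S₃.eq.symm).symm
  have hba₁ : c₁₀ β ≠ c₁₀ α := fun h' ↦ S₁.ne h'.symm
  have hba₂ : c₀₁ β' ≠ c₀₁ α' := fun h' ↦ S₃.ne h'.symm
  have hZ₁ : ∀ x, c₁₀ x = c₁₀ α' ↔ c₀₀ x = c₀₀ α' := fun x ↦ (S₁.eq_iff_of_ne' x h₀).symm
  have hZ₂ : ∀ x, c₀₁ x = c₀₁ α ↔ c₀₀ x = c₀₀ α := fun x ↦ (S₃.eq_iff_of_ne' x (Ne.symm h₀)).symm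
  rw [sum_splitInc_mul S₁ la (fun f ↦ splitInc R h t c₁₀ f nu.1 α' β'),
    sum_splitInc_mul S₃ la (fun f ↦ splitInc R h t c₀₁ f nu.1 α β)]
  simp only [splitInc]
  have hR₁ : ∀ x, ((c₁₀ x ≠ c₁₀ α' ∧ c₁₀ x ≠ c₁₀ α) ∧ c₁₀ x ≠ c₁₀ β) ↔
      (c₀₀ x ≠ c₀₀ α' ∧ c₀₀ x ≠ c₀₀ α) := fun x ↦ by
    simp only [ne_eq]
    rw [hZ₁ x, S₁.eq_iff x, not_or]
    exact and_assoc
  have hR₂ : ∀ x, ((c₀₁ x ≠ c₀₁ α ∧ c₀₁ x ≠ c₀₁ α') ∧ c₀₁ x ≠ c₀₁ β') ↔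
      (c₀₀ x ≠ c₀₀ α' ∧ c₀₀ x ≠ c₀₀ α) := fun x ↦ by
    simp only [ne_eq]
    rw [hZ₂ x, S₃.eq_iff x, not_or]
    exact Iff.intro (fun ⟨⟨h1, h2⟩, h3⟩ ↦ ⟨⟨h2, h3⟩, h1⟩) (fun ⟨⟨h1, h2⟩, h3⟩ ↦ ⟨⟨h3, h1⟩, h2⟩)
  have hb₁ : ∀ v w, (∀ x, c₁₀ x ≠ c₁₀ α' → nu.1 x = upd c₁₀ (upd c₁₀ la.1 β w) α v x) ↔
      v = nu.1 α ∧ (w = nu.1 β ∧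
        ∀ x, (c₀₀ x ≠ c₀₀ α' ∧ c₀₀ x ≠ c₀₀ α) → nu.1 x = la.1 x) := fun v w ↦ by
    rw [forall_upd_of_forall (Q := fun x ↦ c₁₀ x ≠ c₁₀ α') (fun x hx h' ↦ hα' (h'.symm.trans hx))
        fun x hx ↦ nu.2 x α ((S₂.eq_iff_of_ne' x (Ne.symm hα')).mp hx),
      forall_upd_of_forall (Q := fun x ↦ c₁₀ x ≠ c₁₀ α' ∧ c₁₀ x ≠ c₁₀ α)
        (fun x hx ↦ ⟨fun h' ↦ hβ' (h'.symm.trans hx), hx.trans_ne hba₁⟩)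
        fun x hx ↦ nu.2 x β ((S₂.eq_iff_of_ne' x (Ne.symm hβ')).mp hx)]
    exact and_congr_right fun _ ↦ and_congr_right fun _ ↦
      forall_congr' fun x ↦ imp_congr_left (hR₁ x)
  have hb₂ : ∀ v w, (∀ x, c₀₁ x ≠ c₀₁ α → nu.1 x = upd c₀₁ (upd c₀₁ la.1 β' w) α' v x) ↔
      v = nu.1 α' ∧ (w = nu.1 β' ∧
        ∀ x, (c₀₀ x ≠ c₀₀ α' ∧ c₀₀ x ≠ c₀₀ α) → nu.1 x = la.1 x) := fun v w ↦ by
    rw [forall_upd_of_forall (Q := fun x ↦ c₀₁ x ≠ c₀₁ α) (fun x hx h' ↦ hα (h'.symm.trans hx))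
        fun x hx ↦ nu.2 x α' ((S₄.eq_iff_of_ne' x (Ne.symm hα)).mp hx),
      forall_upd_of_forall (Q := fun x ↦ c₀₁ x ≠ c₀₁ α ∧ c₀₁ x ≠ c₀₁ α')
        (fun x hx ↦ ⟨fun h' ↦ hβ (h'.symm.trans hx), hx.trans_ne hba₂⟩)
        fun x hx ↦ nu.2 x β' ((S₄.eq_iff_of_ne' x (Ne.symm hβ)).mp hx)]
    exact and_congr_right fun _ ↦ and_congr_right fun _ ↦
      forall_congr' fun x ↦ imp_congr_left (hR₂ x)
  simp only [hb₁, hb₂, upd_of_ne hα', upd_of_ne hβ', upd_of_ne hα, upd_of_ne hβ,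
    sum_sum_mul_ite_eq_and]
  split_ifs
  · exact mul_comm _ _
  · rfl

omit [DecidableEq Y₃] in
/-- Face split–split, overlapping case (`1 → 2 → 3` circles): chord `i` cuts the circle `Z` into
`A' ∋ α` and `B' ∋ β`, chord `j` cuts `A'` with `α` on the side of `α'`; coassociativity (and
cocommutativity) of `A`. Khovanov (2000), Prop. 8. [cite: Khovanov2000] -/
theorem face_SS_SS_of_eq (S₁ : Surg c₁₀ c₀₀ α β) (S₂ : Surg c₁₁ c₁₀ α' β')
    (S₃ : Surg c₀₁ c₀₀ α' β') (S₄ : Surg c₁₁ c₀₁ α β) (hO₁ : c₁₀ α' = c₁₀ α)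
    (hO₂ : c₁₁ α = c₁₁ α') (la : Lab c₀₀) (nu : Lab c₁₁) :
    ∑ mu : Lab c₁₀, splitInc R h t c₀₀ la.1 mu.1 α β * splitInc R h t c₁₀ mu.1 nu.1 α' β' =
      ∑ mu : Lab c₀₁, splitInc R h t c₀₀ la.1 mu.1 α' β' * splitInc R h t c₀₁ mu.1 nu.1 α β := by
  classical
  have h₀ : c₀₀ α' = c₀₀ α := (S₁.eq_iff α').mpr (Or.inl hO₁)
  have hβ : c₁₀ β ≠ c₁₀ α' := fun h' ↦ S₁.ne (hO₁.symm.trans h'.symm)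
  have hO₂' : c₀₁ α = c₀₁ α' := S₄.le hO₂
  have hβ' : c₀₁ β' ≠ c₀₁ α := fun h' ↦ S₃.ne (h'.trans hO₂').symm
  have hba₁ : c₁₀ β ≠ c₁₀ α := fun h' ↦ S₁.ne h'.symm
  have hba₂ : c₀₁ β' ≠ c₀₁ α' := fun h' ↦ S₃.ne h'.symm
  rw [sum_splitInc_mul S₁ la (fun f ↦ splitInc R h t c₁₀ f nu.1 α' β'),
    sum_splitInc_mul S₃ la (fun f ↦ splitInc R h t c₀₁ f nu.1 α β)]
  simp only [splitInc]
  have hR₁ : ∀ x, (c₁₀ x ≠ c₁₀ α' ∧ c₁₀ x ≠ c₁₀ β) ↔ c₀₀ x ≠ c₀₀ α := fun x ↦ by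
    simp only [ne_eq]
    rw [S₁.eq_iff x, hO₁, not_or]
  have hR₂ : ∀ x, (c₀₁ x ≠ c₀₁ α ∧ c₀₁ x ≠ c₀₁ β') ↔ c₀₀ x ≠ c₀₀ α := fun x ↦ by
    simp only [ne_eq]
    rw [← h₀, S₃.eq_iff x, ← hO₂', not_or]
  have hb₁ : ∀ v w, (∀ x, c₁₀ x ≠ c₁₀ α' → nu.1 x = upd c₁₀ (upd c₁₀ la.1 β w) α v x) ↔
      w = nu.1 β ∧ ∀ x, c₀₀ x ≠ c₀₀ α → nu.1 x = la.1 x := fun v w ↦ by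
    rw [forall_upd_of_forall_not (Q := fun x ↦ c₁₀ x ≠ c₁₀ α') fun x hx h' ↦
        h' (hx.trans hO₁.symm),
      forall_upd_of_forall (Q := fun x ↦ c₁₀ x ≠ c₁₀ α') (fun x hx ↦ hx.trans_ne hβ)
        fun x hx ↦ nu.2 x β ((S₂.eq_iff_of_ne' x hβ).mp hx)]
    exact and_congr_right fun _ ↦ forall_congr' fun x ↦ imp_congr_left (hR₁ x)
  have hb₂ : ∀ v w, (∀ x, c₀₁ x ≠ c₀₁ α → nu.1 x = upd c₀₁ (upd c₀₁ la.1 β' w) α' v x) ↔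
      w = nu.1 β' ∧ ∀ x, c₀₀ x ≠ c₀₀ α → nu.1 x = la.1 x := fun v w ↦ by
    rw [forall_upd_of_forall_not (Q := fun x ↦ c₀₁ x ≠ c₀₁ α) fun x hx h' ↦
        h' (hx.trans hO₂'.symm),
      forall_upd_of_forall (Q := fun x ↦ c₀₁ x ≠ c₀₁ α) (fun x hx ↦ hx.trans_ne hβ')
        fun x hx ↦ nu.2 x β' ((S₄.eq_iff_of_ne' x hβ').mp hx)]
    exact and_congr_right fun _ ↦ forall_congr' fun x ↦ imp_congr_left (hR₂ x)
  simp only [hb₁, hb₂, upd_of_eq hO₁, upd_of_eq hO₂', sum_sum_mul_ite_eq_and_right]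
  split_ifs
  · rw [la.2 _ _ h₀, nu.2 _ _ hO₂]
    exact sum_splitCoeff_splitCoeff_swap' _ _ _ _
  · rfl

omit [DecidableEq Y₃] in
/-- **Face split–split / split–split** (`1 → 2 → 3` circles or two disjoint splits):
coassociativity and cocommutativity of `A`. Khovanov (2000), Prop. 8. [cite: Khovanov2000] -/
theorem face_SS_SS (S₁ : Surg c₁₀ c₀₀ α β) (S₂ : Surg c₁₁ c₁₀ α' β') (S₃ : Surg c₀₁ c₀₀ α' β')
    (S₄ : Surg c₁₁ c₀₁ α β) (la : Lab c₀₀) (nu : Lab c₁₁) :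
    ∑ mu : Lab c₁₀, splitInc R h t c₀₀ la.1 mu.1 α β * splitInc R h t c₁₀ mu.1 nu.1 α' β' =
      ∑ mu : Lab c₀₁, splitInc R h t c₀₀ la.1 mu.1 α' β' * splitInc R h t c₀₁ mu.1 nu.1 α β := by
  by_cases hα' : c₁₀ α' = c₁₀ α
  · -- `α` lies on the circle `A'` cut by the second chord, on the side of `α'` or of `β'`
    rcases (S₂.eq_iff α).mp hα'.symm with hO₂ | hO₂
    · exact face_SS_SS_of_eq S₁ S₂ S₃ S₄ hα' hO₂ la nu
    · have := face_SS_SS_of_eq (R := R) (h := h) (t := t) S₁ S₂.symm S₃.symm S₄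
        (S₂.eq.symm.trans hα') hO₂ la nu
      calc _ = ∑ mu : Lab c₁₀, splitInc R h t c₀₀ la.1 mu.1 α β *
            splitInc R h t c₁₀ mu.1 nu.1 β' α' :=
          Finset.sum_congr rfl fun mu _ ↦ by rw [splitInc_swap S₂.eq]
        _ = _ := this
        _ = _ := Finset.sum_congr rfl fun mu _ ↦ by rw [splitInc_swap S₃.eq]
  · by_cases hβ' : c₁₀ α' = c₁₀ β
    · rcases (S₂.eq_iff β).mp hβ'.symm with hO₂ | hO₂
      · have := face_SS_SS_of_eq (R := R) (h := h) (t := t) S₁.symm S₂ S₃ S₄.symm hβ' hO₂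
          la nu
        calc _ = ∑ mu : Lab c₁₀, splitInc R h t c₀₀ la.1 mu.1 β α *
              splitInc R h t c₁₀ mu.1 nu.1 α' β' :=
            Finset.sum_congr rfl fun mu _ ↦ by rw [splitInc_swap S₁.eq]
          _ = _ := this
          _ = _ := Finset.sum_congr rfl fun mu _ ↦ by rw [splitInc_swap S₄.eq]
      · have := face_SS_SS_of_eq (R := R) (h := h) (t := t) S₁.symm S₂.symm S₃.symm S₄.symm
          (S₂.eq.symm.trans hβ') hO₂ la nu
        calc _ = ∑ mu : Lab c₁₀, splitInc R h t c₀₀ la.1 mu.1 β α *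
              splitInc R h t c₁₀ mu.1 nu.1 β' α' :=
            Finset.sum_congr rfl fun mu _ ↦ by rw [splitInc_swap S₁.eq, splitInc_swap S₂.eq]
          _ = _ := this
          _ = _ := Finset.sum_congr rfl fun mu _ ↦ by
            rw [splitInc_swap S₃.eq, splitInc_swap S₄.eq]
    · exact face_SS_SS_disjoint S₁ S₂ S₃ S₄ hα' hβ' la nu

/-- Face split–merge / merge–split, disjoint case: chord `i` cuts one circle, chord `j` joins two
other circles. Khovanov (2000), Prop. 8. [cite: Khovanov2000] -/
theorem face_SM_MS_disjoint (S₁ : Surg c₁₀ c₀₀ α β) (S₂ : Surg c₁₀ c₁₁ α' β')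
    (S₃ : Surg c₀₀ c₀₁ α' β') (S₄ : Surg c₁₁ c₀₁ α β)
    (hα' : c₀₀ α' ≠ c₀₀ α) (hβ' : c₀₀ β' ≠ c₀₀ α) (la : Lab c₀₀) (nu : Lab c₁₁) :
    ∑ mu : Lab c₁₀, splitInc R h t c₀₀ la.1 mu.1 α β * mergeInc R h t c₁₁ mu.1 nu.1 α' β' =
      ∑ mu : Lab c₀₁, mergeInc R h t c₀₁ la.1 mu.1 α' β' * splitInc R h t c₀₁ mu.1 nu.1 α β := by
  classical
  have hZα' : ∀ x, c₁₀ x = c₁₀ α' ↔ c₀₀ x = c₀₀ α' := fun x ↦ (S₁.eq_iff_of_ne' x hα').symm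
  have hZβ' : ∀ x, c₁₀ x = c₁₀ β' ↔ c₀₀ x = c₀₀ β' := fun x ↦ (S₁.eq_iff_of_ne' x hβ').symm
  have hba₁ : c₁₀ β ≠ c₁₀ α := fun h' ↦ S₁.ne h'.symm
  have h₁ : c₁₀ α ≠ c₁₀ α' := fun h' ↦ hα' ((hZα' α).mp h').symm
  have h₂ : c₁₀ α ≠ c₁₀ β' := fun h' ↦ hβ' ((hZβ' α).mp h').symm
  have h₃ : c₁₀ β ≠ c₁₀ α' := fun h' ↦ hα' (((hZα' β).mp h').symm.trans S₁.eq.symm)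
  have h₄ : c₁₀ β ≠ c₁₀ β' := fun h' ↦ hβ' (((hZβ' β).mp h').symm.trans S₁.eq.symm)
  have hK : ∀ x, c₁₁ x = c₁₁ α' ↔ c₀₀ x = c₀₀ α' ∨ c₀₀ x = c₀₀ β' := fun x ↦ by
    rw [S₂.eq_iff, hZα', hZβ']
  have hα : c₀₁ α ≠ c₀₁ α' := fun h' ↦ by
    rcases (S₃.eq_iff α).mp h' with h'' | h''
    · exact hα' h''.symm
    · exact hβ' h''.symm
  have hW : ∀ x, c₀₁ x = c₀₁ α ↔ c₀₀ x = c₀₀ α := fun x ↦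
    S₃.eq_iff_of_ne x (Ne.symm hα') (Ne.symm hβ')
  rw [sum_splitInc_mul S₁ la (fun f ↦ mergeInc R h t c₁₁ f nu.1 α' β'),
    sum_mergeInc_mul S₃ la (fun f ↦ splitInc R h t c₀₁ f nu.1 α β)]
  simp only [splitInc, mergeInc]
  have hR₁ : ∀ x, ((c₁₁ x ≠ c₁₁ α' ∧ c₁₀ x ≠ c₁₀ α) ∧ c₁₀ x ≠ c₁₀ β) ↔
      (¬ (c₀₀ x = c₀₀ α' ∨ c₀₀ x = c₀₀ β') ∧ c₀₀ x ≠ c₀₀ α) := fun x ↦ by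
    simp only [ne_eq]
    rw [hK x, S₁.eq_iff x, not_or, not_or]
    exact and_assoc
  have hR₂ : ∀ x, (c₀₁ x ≠ c₀₁ α ∧ c₀₁ x ≠ c₀₁ α') ↔
      (¬ (c₀₀ x = c₀₀ α' ∨ c₀₀ x = c₀₀ β') ∧ c₀₀ x ≠ c₀₀ α) := fun x ↦ by
    simp only [ne_eq]
    rw [hW x, S₃.eq_iff x]
    exact and_comm
  have hb₁ : ∀ v w, (∀ x, c₁₁ x ≠ c₁₁ α' → nu.1 x = upd c₁₀ (upd c₁₀ la.1 β w) α v x) ↔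
      v = nu.1 α ∧ (w = nu.1 β ∧
        ∀ x, (¬ (c₀₀ x = c₀₀ α' ∨ c₀₀ x = c₀₀ β') ∧ c₀₀ x ≠ c₀₀ α) → nu.1 x = la.1 x) :=
      fun v w ↦ by
    rw [forall_upd_of_forall (Q := fun x ↦ c₁₁ x ≠ c₁₁ α')
        (fun x hx h' ↦ ((S₂.eq_iff x).mp h').elim (fun h'' ↦ h₁ (hx.symm.trans h''))
          fun h'' ↦ h₂ (hx.symm.trans h''))
        fun x hx ↦ nu.2 x α (S₂.le hx),
      forall_upd_of_forall (Q := fun x ↦ c₁₁ x ≠ c₁₁ α' ∧ c₁₀ x ≠ c₁₀ α)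
        (fun x hx ↦ ⟨fun h' ↦ ((S₂.eq_iff x).mp h').elim (fun h'' ↦ h₃ (hx.symm.trans h''))
          fun h'' ↦ h₄ (hx.symm.trans h''), hx.trans_ne hba₁⟩)
        fun x hx ↦ nu.2 x β (S₂.le hx)]
    exact and_congr_right fun _ ↦ and_congr_right fun _ ↦
      forall_congr' fun x ↦ imp_congr_left (hR₁ x)
  have hb₂ : ∀ v, (∀ x, c₀₁ x ≠ c₀₁ α → nu.1 x = upd c₀₁ la.1 α' v x) ↔
      v = nu.1 α' ∧
        ∀ x, (¬ (c₀₀ x = c₀₀ α' ∨ c₀₀ x = c₀₀ β') ∧ c₀₀ x ≠ c₀₀ α) → nu.1 x = la.1 x :=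
      fun v ↦ by
    rw [forall_upd_of_forall (Q := fun x ↦ c₀₁ x ≠ c₀₁ α) (fun x hx ↦ hx.trans_ne (Ne.symm hα))
        fun x hx ↦ nu.2 x α' ((S₄.eq_iff_of_ne' x (Ne.symm hα)).mp hx)]
    exact and_congr_right fun _ ↦ forall_congr' fun x ↦ imp_congr_left (hR₂ x)
  simp only [hb₁, hb₂, upd_of_ne (Ne.symm h₁), upd_of_ne (Ne.symm h₃), upd_of_ne (Ne.symm h₂),
    upd_of_ne (Ne.symm h₄), upd_of_ne hα, sum_sum_mul_ite_eq_and, sum_mul_ite_eq_and]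
  split_ifs
  · exact mul_comm _ _
  · rfl

/-- Face split–merge / merge–split, overlapping case: chord `i` cuts the circle `Z ∋ α, β` into
`A' ∋ α, α'` and `B' ∋ β`, chord `j` joins the side of `α'` to a further circle `∋ β'`; the
Frobenius identity `Δ(a)·d = Δ(a·d)`. Khovanov (2000), Prop. 8. [cite: Khovanov2000] -/
theorem face_SM_MS_of_eq (S₁ : Surg c₁₀ c₀₀ α β) (S₂ : Surg c₁₀ c₁₁ α' β')
    (S₃ : Surg c₀₀ c₀₁ α' β') (hF : c₁₀ α' = c₁₀ α) (la : Lab c₀₀) (nu : Lab c₁₁) :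
    ∑ mu : Lab c₁₀, splitInc R h t c₀₀ la.1 mu.1 α β * mergeInc R h t c₁₁ mu.1 nu.1 α' β' =
      ∑ mu : Lab c₀₁, mergeInc R h t c₀₁ la.1 mu.1 α' β' * splitInc R h t c₀₁ mu.1 nu.1 α β := by
  classical
  have h₀ : c₀₀ α' = c₀₀ α := (S₁.eq_iff α').mpr (Or.inl hF)
  have hβ' : c₀₀ β' ≠ c₀₀ α := fun h' ↦ S₃.ne (h₀.trans h'.symm)
  have hZβ' : ∀ x, c₁₀ x = c₁₀ β' ↔ c₀₀ x = c₀₀ β' := fun x ↦ (S₁.eq_iff_of_ne' x hβ').symm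
  have hba₁ : c₁₀ β ≠ c₁₀ α := fun h' ↦ S₁.ne h'.symm
  have h₃ : c₁₀ β ≠ c₁₀ α' := hba₁.trans_eq hF.symm
  have h₄ : c₁₀ β ≠ c₁₀ β' := fun h' ↦ hβ' (((hZβ' β).mp h').symm.trans S₁.eq.symm)
  have h₂ : c₁₀ β' ≠ c₁₀ α := fun h' ↦ S₂.ne (hF.trans h'.symm)
  have hK : c₁₁ α = c₁₁ α' := S₂.le hF.symm
  have hO₂ : c₀₁ α = c₀₁ α' := (S₃.eq_iff α).mpr (Or.inl h₀.symm)
  rw [sum_splitInc_mul S₁ la (fun f ↦ mergeInc R h t c₁₁ f nu.1 α' β'),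
    sum_mergeInc_mul S₃ la (fun f ↦ splitInc R h t c₀₁ f nu.1 α β)]
  simp only [splitInc, mergeInc]
  have hR₁ : ∀ x, (c₁₁ x ≠ c₁₁ α' ∧ c₁₀ x ≠ c₁₀ β) ↔ (c₀₀ x ≠ c₀₀ α ∧ c₀₀ x ≠ c₀₀ β') :=
      fun x ↦ by
    simp only [ne_eq]
    rw [S₂.eq_iff x, hF, hZβ' x, S₁.eq_iff x, not_or, not_or]
    exact Iff.intro (fun ⟨⟨h1, h2⟩, h3⟩ ↦ ⟨⟨h1, h3⟩, h2⟩) (fun ⟨⟨h1, h2⟩, h3⟩ ↦ ⟨⟨h1, h3⟩, h2⟩)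
  have hR₂ : ∀ x, c₀₁ x ≠ c₀₁ α ↔ (c₀₀ x ≠ c₀₀ α ∧ c₀₀ x ≠ c₀₀ β') := fun x ↦ by
    simp only [ne_eq]
    rw [hO₂, S₃.eq_iff x, h₀, not_or]
  have hb₁ : ∀ v w, (∀ x, c₁₁ x ≠ c₁₁ α' → nu.1 x = upd c₁₀ (upd c₁₀ la.1 β w) α v x) ↔
      w = nu.1 β ∧ ∀ x, (c₀₀ x ≠ c₀₀ α ∧ c₀₀ x ≠ c₀₀ β') → nu.1 x = la.1 x := fun v w ↦ by
    rw [forall_upd_of_forall_not (Q := fun x ↦ c₁₁ x ≠ c₁₁ α') fun x hx h' ↦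
        h' ((S₂.le hx).trans hK),
      forall_upd_of_forall (Q := fun x ↦ c₁₁ x ≠ c₁₁ α')
        (fun x hx h' ↦ ((S₂.eq_iff x).mp h').elim (fun h'' ↦ h₃ (hx.symm.trans h''))
          fun h'' ↦ h₄ (hx.symm.trans h''))
        fun x hx ↦ nu.2 x β (S₂.le hx)]
    exact and_congr_right fun _ ↦ forall_congr' fun x ↦ imp_congr_left (hR₁ x)
  have hb₂ : ∀ v, (∀ x, c₀₁ x ≠ c₀₁ α → nu.1 x = upd c₀₁ la.1 α' v x) ↔
      ∀ x, (c₀₀ x ≠ c₀₀ α ∧ c₀₀ x ≠ c₀₀ β') → nu.1 x = la.1 x := fun v ↦ by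
    rw [forall_upd_of_forall_not (Q := fun x ↦ c₀₁ x ≠ c₀₁ α) fun x hx h' ↦
        h' (hx.trans hO₂.symm)]
    exact forall_congr' fun x ↦ imp_congr_left (hR₂ x)
  simp only [hb₁, hb₂, upd_of_eq hF, upd_of_ne h₂, upd_of_ne (Ne.symm h₄), upd_of_eq hO₂,
    sum_sum_mul_ite_eq_and_right, sum_mul_ite]
  split_ifs
  · rw [la.2 _ _ h₀, nu.2 _ _ hK]
    exact sum_splitCoeff_mergeCoeff _ _ _ _
  · rfl

/-- **Face split–merge / merge–split**: the Frobenius identity (overlapping case) or two disjoint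
surgeries. Khovanov (2000), Prop. 8. [cite: Khovanov2000] -/
theorem face_SM_MS (S₁ : Surg c₁₀ c₀₀ α β) (S₂ : Surg c₁₀ c₁₁ α' β') (S₃ : Surg c₀₀ c₀₁ α' β')
    (S₄ : Surg c₁₁ c₀₁ α β) (la : Lab c₀₀) (nu : Lab c₁₁) :
    ∑ mu : Lab c₁₀, splitInc R h t c₀₀ la.1 mu.1 α β * mergeInc R h t c₁₁ mu.1 nu.1 α' β' =
      ∑ mu : Lab c₀₁, mergeInc R h t c₀₁ la.1 mu.1 α' β' * splitInc R h t c₀₁ mu.1 nu.1 α β := by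
  by_cases hα' : c₀₀ α' = c₀₀ α
  · rcases (S₁.eq_iff α').mp hα' with hF | hF
    · exact face_SM_MS_of_eq S₁ S₂ S₃ hF la nu
    · have := face_SM_MS_of_eq (R := R) (h := h) (t := t) S₁.symm S₂ S₃ hF la nu
      calc _ = ∑ mu : Lab c₁₀, splitInc R h t c₀₀ la.1 mu.1 β α *
            mergeInc R h t c₁₁ mu.1 nu.1 α' β' :=
          Finset.sum_congr rfl fun mu _ ↦ by rw [splitInc_swap S₁.eq]
        _ = _ := this
        _ = _ := Finset.sum_congr rfl fun mu _ ↦ by rw [splitInc_swap S₄.eq]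
  · by_cases hβ' : c₀₀ β' = c₀₀ α
    · rcases (S₁.eq_iff β').mp hβ' with hF | hF
      · have := face_SM_MS_of_eq (R := R) (h := h) (t := t) S₁ S₂.symm S₃.symm hF la nu
        calc _ = ∑ mu : Lab c₁₀, splitInc R h t c₀₀ la.1 mu.1 α β *
              mergeInc R h t c₁₁ mu.1 nu.1 β' α' :=
            Finset.sum_congr rfl fun mu _ ↦ by rw [mergeInc_swap S₂.eq]
          _ = _ := this
          _ = _ := Finset.sum_congr rfl fun mu _ ↦ by rw [mergeInc_swap S₃.eq]
      · have := face_SM_MS_of_eq (R := R) (h := h) (t := t) S₁.symm S₂.symm S₃.symm hF la nu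
        calc _ = ∑ mu : Lab c₁₀, splitInc R h t c₀₀ la.1 mu.1 β α *
              mergeInc R h t c₁₁ mu.1 nu.1 β' α' :=
            Finset.sum_congr rfl fun mu _ ↦ by rw [splitInc_swap S₁.eq, mergeInc_swap S₂.eq]
          _ = _ := this
          _ = _ := Finset.sum_congr rfl fun mu _ ↦ by
            rw [mergeInc_swap S₃.eq, splitInc_swap S₄.eq]
    · exact face_SM_MS_disjoint S₁ S₂ S₃ S₄ hα' hβ' la nu

/-- **The face theorem** (two-dimensional faces of the cube of resolutions commute, before the
Koszul signs): for each of the sixteen patterns of kinds on the four edges of a face, compatible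
with the surgery relations, the sums of products of unsigned incidence numbers along the two
paths agree. Ten patterns contradict the surgery relations (the number of circles changes by the
same amount along both paths); the six consistent ones are `face_MM_MM`, `face_SS_SS`,
`face_MS_MS`, `face_SM_SM`, `face_SM_MS` and its mirror image. This replaces the functoriality of
the TQFT in Khovanov's proof. Khovanov (2000), Prop. 8; Bar-Natan (2002), §3.2. [cite: Khovanov2000] -/
theorem face_comm (k₁ k₂ k₃ k₄ : Kind) (h₁ : EdgeOK k₁ c₀₀ c₁₀ α β)
    (h₂ : EdgeOK k₂ c₁₀ c₁₁ α' β') (h₃ : EdgeOK k₃ c₀₀ c₀₁ α' β') (h₄ : EdgeOK k₄ c₀₁ c₁₁ α β)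
    (la : Lab c₀₀) (nu : Lab c₁₁) :
    ∑ mu : Lab c₁₀, edgeVal R h t k₁ c₀₀ c₁₀ la.1 mu.1 α β *
        edgeVal R h t k₂ c₁₀ c₁₁ mu.1 nu.1 α' β' =
      ∑ mu : Lab c₀₁, edgeVal R h t k₃ c₀₀ c₀₁ la.1 mu.1 α' β' *
        edgeVal R h t k₄ c₀₁ c₁₁ mu.1 nu.1 α β := by
  cases k₁ <;> cases k₂ <;> cases k₃ <;> cases k₄ <;> simp only [edgeVal, EdgeOK] at h₁ h₂ h₃ h₄ ⊢
  · exact face_MM_MM h₁ h₂ h₃ h₄ la nu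
  · exact absurd (h₂.le h₁.eq) h₄.ne
  · exact absurd (h₁.le h₃.eq) h₂.ne
  · exact absurd (h₁.le h₃.eq) h₂.ne
  · exact absurd (h₄.le h₃.eq) h₂.ne
  · exact face_MS_MS h₁ h₂ h₃ h₄ la nu
  · exact (face_SM_MS h₃ h₄ h₁ h₂ la nu).symm
  · exact absurd (h₃.le h₄.eq) h₁.ne
  · exact absurd (h₃.le h₁.eq) h₄.ne
  · exact face_SM_MS h₁ h₂ h₃ h₄ la nu
  · exact face_SM_SM h₁ h₂ h₃ h₄ la nu
  · exact absurd (h₄.le h₂.eq) h₃.ne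
  · exact absurd (h₁.le h₂.eq) h₃.ne
  · exact absurd (h₁.le h₂.eq) h₃.ne
  · exact absurd (h₂.le h₄.eq) h₁.ne
  · exact face_SS_SS h₁ h₂ h₃ h₄ la nu

end Faces

end KhFace

end Literature.Topology.FourManifolds
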